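import Summits.CriticalPhenomena.PercolationContinuityZ3.Theorems.PercNearOneGluingNoHeavyRsw3InvasionBackboneExists
import Summits.CriticalPhenomena.PercolationContinuityZ3.Theorems.PercNearOneGluingNoHeavyRsw3InvasionWMSF
import Literature.Barriers.CriticalPhenomena.SubexponentialGrowthZdCoupling
import HarnessLib

/-!
# RSW3 lane (P2, gen 29): INVASION PERCOLATION XXXVII — EQUIVARIANCE OF THE INVASION UNDER GRAPH ISOMORPHISMS (injective labels) AND
# **A.S. EVERY INVASION TREE `T(x)`, `x ∈ ℤ^d`, HAS EXACTLY ONE RAY FROM ITS ROOT** (`d ≥ 2`, p205010)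

builds on p205010 (kernel theorem, internal audit signed; external expert review pending) — used only in §3 (through file XXXVI).

Cell `prim-rsw3`, prover seat `prim-rsw3-p2` (gen 29), memo `run/shared/lean/prim/rsw3/P2-RSWLITE.md` §36.  Support file
(`--supports stmt-CriticalPhenomena-4575`); no definitions, no named facts, no sorries.

The `ℤ^d` statements of files XXX–XXXVI are for the invasion from the ORIGIN (the tree's Chayes–Chayes–Newman Thm 3.2, gen 26 file IV, is stated for root `0`).
Here they are transported to every root by lattice translations.  §1: for a graph isomorphism `φ : G ≃g G'` and labels with `U' s(φ u, φ v) = U s(u, v)`, the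
invasion is EQUIVARIANT as soon as the labels are injective on the bonds of `G` (then the minimising boundary dart is unique, so the tie-breaking choice in
`Invasion.newDart` is immaterial): `invasion G' U' (φ o) n = (invasion G U o n).image φ`, `acceptedLabel` and `IsOutlet` are invariant, tree adjacency is
transported, and so are rays from the root (`existsUnique_ray_iff_of_iso`).  §2: on `ℤ^d` the labels are a.s. injective and the label measure is invariant under
the relabelling `U ↦ U ∘ Sym2.map (· + x)` (the Literature library's `labelMeasure_map_comp`).  §3: hence **a.s., simultaneously for every `x ∈ ℤ^d`, the
invasion tree `T(x)` has outlets beyond every time and EXACTLY ONE self-avoiding ray from `x`** (`ae_forall_root_existsUnique_ray`) — with file XXXIV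
(`𝔉_w = ⋃_x T(x)`): the WMSF of `ℤ^d` is a.s. a union of one-ended trees (`ae_wmsf_eq_iUnion_oneEnded_trees`).

References: R. Lyons, Y. Peres, O. Schramm, Ann. Probab. 34 (2006), §3 (invasion trees; Prop. 3.3; Thm. 3.12) [LyonsPeresSchramm2006].
-/

noncomputable section

namespace Summit.CriticalPhenomena.PercolationContinuityZ3.Theorems.Rsw3

open Finset Filter MeasureTheory Literature.Probability.LatticeModels Literature.Probability.Percolation Literature.Probability.Percolation.Invasion

/-! ## §1 Equivariance under a graph isomorphism (injective labels) -/

section Iso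

variable {V W : Type*} [DecidableEq V] [DecidableEq W] {G : SimpleGraph V} [G.LocallyFinite] {G' : SimpleGraph W} [G'.LocallyFinite]

/-- Boundary darts are transported by a graph isomorphism. [cite: LyonsPeresSchramm2006, §3 (invasion tree)] -/
theorem boundaryDarts_image_iso (φ : G ≃g G') (I : Finset V) :
    boundaryDarts G' (I.image φ) = (boundaryDarts G I).image (Prod.map φ φ) := by
  ext b
  simp only [mem_boundaryDarts, mem_image, Prod.exists, Prod.map_apply]
  constructor
  · rintro ⟨⟨x, hx, hxb⟩, hb2, hadj⟩
    obtain ⟨y, hy⟩ := φ.surjective b.2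
    refine ⟨x, y, ⟨hx, fun hyI => hb2 ⟨y, hyI, hy⟩, ?_⟩, ?_⟩
    · rw [← φ.map_adj_iff, hxb, hy]; exact hadj
    · exact Prod.ext hxb hy
  · rintro ⟨x, y, ⟨hx, hy, hadj⟩, rfl⟩
    refine ⟨⟨x, hx, rfl⟩, fun ⟨z, hz, hzy⟩ => hy ?_, φ.map_adj_iff.2 hadj⟩
    rwa [← φ.injective hzy]

/-- With injective labels (on the bonds of `G`) the minimising boundary dart is unique. [cite: LyonsPeresSchramm2006, §3 (injective labeling)] -/
theorem eq_of_mem_minDarts_of_injOn {U : Sym2 V → ℝ} (hU : Set.InjOn U G.edgeSet) {I : Finset V} {a b : V × V}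
    (ha : a ∈ minDarts G U I) (hb : b ∈ minDarts G U I) : a = b := by
  obtain ⟨haB, hamin⟩ := (mem_minDarts G).1 ha
  obtain ⟨hbB, hbmin⟩ := (mem_minDarts G).1 hb
  obtain ⟨ha1, ha2, hadjA⟩ := (mem_boundaryDarts G).1 haB
  obtain ⟨hb1, hb2, hadjB⟩ := (mem_boundaryDarts G).1 hbB
  have heq : s(a.1, a.2) = s(b.1, b.2) := hU hadjA hadjB (le_antisymm (hamin b hbB) (hbmin a haB))
  rcases Sym2.eq_iff.1 heq with ⟨h1, h2⟩ | ⟨h1, h2⟩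
  · exact Prod.ext h1 h2
  · exact absurd (h1 ▸ ha1) hb2

/-- With injective labels, `newDart` returns THE minimising dart. [cite: LyonsPeresSchramm2006, §3 (injective labeling)] -/
theorem newDart_eq_some_of_mem_minDarts {U : Sym2 V → ℝ} (hU : Set.InjOn U G.edgeSet) {I : Finset V} {a : V × V}
    (ha : a ∈ minDarts G U I) : newDart G U I = some a := by
  obtain ⟨a', ha'⟩ := exists_newDart_eq_some (U := U) (I := I) ⟨a, ((mem_minDarts G).1 ha).1⟩
  rw [ha', eq_of_mem_minDarts_of_injOn hU (newDart_mem G ha') ha]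

omit [DecidableEq V] [DecidableEq W] [G.LocallyFinite] [G'.LocallyFinite] in
/-- Labels transported along an isomorphism stay injective on bonds. [cite: LyonsPeresSchramm2006, §3] -/
theorem injOn_of_iso (φ : G ≃g G') {U : Sym2 V → ℝ} {U' : Sym2 W → ℝ} (hUU' : ∀ u v, U' s(φ u, φ v) = U s(u, v))
    (hU : Set.InjOn U G.edgeSet) : Set.InjOn U' G'.edgeSet := by
  rintro e₁ he₁ e₂ he₂ h
  induction e₁ using Sym2.ind with
  | h u₁ v₁ =>
  induction e₂ using Sym2.ind with
  | h u₂ v₂ =>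
  obtain ⟨x₁, rfl⟩ := φ.surjective u₁
  obtain ⟨y₁, rfl⟩ := φ.surjective v₁
  obtain ⟨x₂, rfl⟩ := φ.surjective u₂
  obtain ⟨y₂, rfl⟩ := φ.surjective v₂
  rw [hUU', hUU'] at h
  have h₁ : s(x₁, y₁) ∈ G.edgeSet := φ.map_adj_iff.1 he₁
  have h₂ : s(x₂, y₂) ∈ G.edgeSet := φ.map_adj_iff.1 he₂
  have := hU h₁ h₂ h
  rcases Sym2.eq_iff.1 this with ⟨h1, h2⟩ | ⟨h1, h2⟩
  · rw [h1, h2]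
  · rw [h1, h2, Sym2.eq_swap]

/-- Minimising darts are transported. [cite: LyonsPeresSchramm2006, §3 (invasion tree)] -/
theorem mem_minDarts_image_iso (φ : G ≃g G') {U : Sym2 V → ℝ} {U' : Sym2 W → ℝ} (hUU' : ∀ u v, U' s(φ u, φ v) = U s(u, v))
    {I : Finset V} {a : V × V} (ha : a ∈ minDarts G U I) : (φ a.1, φ a.2) ∈ minDarts G' U' (I.image φ) := by
  obtain ⟨haB, hamin⟩ := (mem_minDarts G).1 ha
  refine (mem_minDarts G').2 ⟨?_, fun b hb => ?_⟩
  · rw [boundaryDarts_image_iso]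
    exact mem_image.2 ⟨a, haB, rfl⟩
  · rw [boundaryDarts_image_iso, mem_image] at hb
    obtain ⟨c, hc, rfl⟩ := hb
    rw [Prod.map_fst, Prod.map_snd, hUU', hUU']
    exact hamin c hc

/-- **`newDart` is equivariant for injective labels.** [cite: LyonsPeresSchramm2006, §3 (invasion tree)] -/
theorem newDart_image_iso (φ : G ≃g G') {U : Sym2 V → ℝ} {U' : Sym2 W → ℝ} (hUU' : ∀ u v, U' s(φ u, φ v) = U s(u, v))
    (hU : Set.InjOn U G.edgeSet) (I : Finset V) : newDart G' U' (I.image φ) = (newDart G U I).map (Prod.map φ φ) := by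
  cases hd : newDart G U I with
  | none =>
    rw [Option.map_none, newDart_eq_none_iff, boundaryDarts_image_iso, image_nonempty]
    exact (newDart_eq_none_iff G).1 hd
  | some a =>
    rw [Option.map_some]
    exact newDart_eq_some_of_mem_minDarts (injOn_of_iso φ hUU' hU) (mem_minDarts_image_iso φ hUU' (newDart_mem G hd))

/-- **The invasion is equivariant** (injective labels): `invasion G' U' (φ o) n = (invasion G U o n).image φ`. [cite: LyonsPeresSchramm2006, §3 (invasion tree)] -/
theorem invasion_image_iso (φ : G ≃g G') {U : Sym2 V → ℝ} {U' : Sym2 W → ℝ} (hUU' : ∀ u v, U' s(φ u, φ v) = U s(u, v))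
    (hU : Set.InjOn U G.edgeSet) (o : V) : ∀ n : ℕ, invasion G' U' (φ o) n = (invasion G U o n).image φ
  | 0 => by rw [invasion_zero, invasion_zero, image_singleton]
  | n + 1 => by
    rw [invasion_succ, invasion_succ, invasion_image_iso φ hUU' hU o n]
    cases hd : newDart G U (invasion G U o n) with
    | none =>
      rw [step_of_eq_none G hd, step_of_eq_none G']
      rw [newDart_image_iso φ hUU' hU, hd, Option.map_none]
    | some a =>
      rw [step_of_eq_some G hd, step_of_eq_some G' (a := (φ a.1, φ a.2)), image_insert]
      rw [newDart_image_iso φ hUU' hU, hd, Option.map_some, Prod.map_apply]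

/-- Accepted labels are invariant. [cite: LyonsPeresSchramm2006, §3 (invasion tree)] -/
theorem acceptedLabel_iso (φ : G ≃g G') {U : Sym2 V → ℝ} {U' : Sym2 W → ℝ} (hUU' : ∀ u v, U' s(φ u, φ v) = U s(u, v))
    (hU : Set.InjOn U G.edgeSet) (o : V) (n : ℕ) : acceptedLabel G' U' (φ o) n = acceptedLabel G U o n := by
  rw [acceptedLabel, acceptedLabel, invasion_image_iso φ hUU' hU o n, newDart_image_iso φ hUU' hU]
  cases newDart G U (invasion G U o n) with
  | none => rfl
  | some a =>
    show U' s((Prod.map φ φ a).1, (Prod.map φ φ a).2) = U s(a.1, a.2)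
    rw [Prod.map_fst, Prod.map_snd, hUU']

/-- Outlet steps are invariant. [cite: LyonsPeresSchramm2006, Thm. 3.12 (proof)] -/
theorem isOutlet_iso_iff (φ : G ≃g G') {U : Sym2 V → ℝ} {U' : Sym2 W → ℝ} (hUU' : ∀ u v, U' s(φ u, φ v) = U s(u, v))
    (hU : Set.InjOn U G.edgeSet) (o : V) (m : ℕ) : IsOutlet G' U' (φ o) m ↔ IsOutlet G U o m := by
  simp only [isOutlet_iff, acceptedLabel_iso φ hUU' hU]

/-- Tree adjacency is transported. [cite: LyonsPeresSchramm2006, §3 (invasion tree)] -/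
theorem tree_adj_iso_iff (φ : G ≃g G') {U : Sym2 V → ℝ} {U' : Sym2 W → ℝ} (hUU' : ∀ u v, U' s(φ u, φ v) = U s(u, v))
    (hU : Set.InjOn U G.edgeSet) (o u v : V) : (tree G' U' (φ o)).Adj (φ u) (φ v) ↔ (tree G U o).Adj u v := by
  rw [tree_adj, tree_adj, mem_treeEdges, mem_treeEdges, φ.injective.ne_iff]
  refine and_congr_left fun _ => ⟨?_, ?_⟩
  · rintro ⟨n, a', ha', he⟩
    rw [invasion_image_iso φ hUU' hU, newDart_image_iso φ hUU' hU] at ha'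
    cases hd : newDart G U (invasion G U o n) with
    | none => rw [hd] at ha'; cases ha'
    | some a =>
      rw [hd, Option.map_some] at ha'
      obtain rfl : (φ a.1, φ a.2) = a' := Option.some_injective _ ha'
      refine ⟨n, a, hd, ?_⟩
      have : Sym2.map φ s(a.1, a.2) = Sym2.map φ s(u, v) := by simpa only [Sym2.map_mk] using he
      exact Sym2.map.injective φ.injective this
  · rintro ⟨n, a, ha, he⟩
    refine ⟨n, (φ a.1, φ a.2), ?_, ?_⟩
    · rw [invasion_image_iso φ hUU' hU, newDart_image_iso φ hUU' hU, ha, Option.map_some, Prod.map_apply]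
    · simpa only [Sym2.map_mk] using congrArg (Sym2.map φ) he

/-- **Rays from the root are transported**: `r` is a self-avoiding ray of `tree G U o` from `o` iff `φ ∘ r` is one of `tree G' U' (φ o)` from `φ o`; hence unique
existence of the ray transfers. [cite: LyonsPeresSchramm2006, Thm. 3.12 (proof)] -/
theorem existsUnique_ray_iff_of_iso (φ : G ≃g G') {U : Sym2 V → ℝ} {U' : Sym2 W → ℝ} (hUU' : ∀ u v, U' s(φ u, φ v) = U s(u, v))
    (hU : Set.InjOn U G.edgeSet) (o : V) :
    (∃! r : ℕ → W, Function.Injective r ∧ r 0 = φ o ∧ ∀ i, (tree G' U' (φ o)).Adj (r i) (r (i + 1))) ↔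
      ∃! r : ℕ → V, Function.Injective r ∧ r 0 = o ∧ ∀ i, (tree G U o).Adj (r i) (r (i + 1)) := by
  have key : ∀ r : ℕ → V, (Function.Injective r ∧ r 0 = o ∧ ∀ i, (tree G U o).Adj (r i) (r (i + 1))) ↔
      (Function.Injective (φ ∘ r) ∧ (φ ∘ r) 0 = φ o ∧ ∀ i, (tree G' U' (φ o)).Adj ((φ ∘ r) i) ((φ ∘ r) (i + 1))) := by
    intro r
    simp only [Function.comp_apply, φ.injective.eq_iff, tree_adj_iso_iff φ hUU' hU]
    exact and_congr_left fun _ => ⟨fun h => φ.injective.comp h, fun h => h.of_comp⟩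
  constructor
  · rintro ⟨r', hr', huniq⟩
    have h : φ ∘ (φ.symm ∘ r') = r' := funext fun i => φ.apply_symm_apply (r' i)
    refine ⟨φ.symm ∘ r', (key _).2 (by rw [h]; exact hr'), fun r hr => ?_⟩
    have hrr' : φ ∘ r = r' := huniq (φ ∘ r) ((key r).1 hr)
    calc r = φ.symm ∘ (φ ∘ r) := funext fun i => (φ.symm_apply_apply (r i)).symm
      _ = φ.symm ∘ r' := by rw [hrr']
  · rintro ⟨r, hr, huniq⟩
    refine ⟨φ ∘ r, (key r).1 hr, fun r' hr' => ?_⟩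
    have h : φ ∘ (φ.symm ∘ r') = r' := funext fun i => φ.apply_symm_apply (r' i)
    have hr'' : Function.Injective (φ.symm ∘ r') ∧ (φ.symm ∘ r') 0 = o ∧
        ∀ i, (tree G U o).Adj ((φ.symm ∘ r') i) ((φ.symm ∘ r') (i + 1)) := (key _).2 (by rw [h]; exact hr')
    calc r' = φ ∘ (φ.symm ∘ r') := h.symm
      _ = φ ∘ r := by rw [huniq _ hr'']

end Iso

/-! ## §2 `ℤ^d`: translations -/

variable {d : ℕ}

/-- **Transport to an arbitrary root**: for labels `U` injective on the bonds of `ℤ^d` and a root `x`, unique existence of the ray from `x` in `T_U(x)` is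
equivalent to unique existence of the ray from `0` in the invasion tree of the pulled-back labels `U ∘ Sym2.map (· + x)`.
[cite: LyonsPeresSchramm2006, Thm. 3.12 (proof)] -/
theorem existsUnique_ray_root_iff (x : Site d) {U : Sym2 (Site d) → ℝ} (hU : Function.Injective U) :
    (∃! r : ℕ → Site d, Function.Injective r ∧ r 0 = x ∧ ∀ i, (tree (zdGraph d) U x).Adj (r i) (r (i + 1))) ↔
      ∃! r : ℕ → Site d, Function.Injective r ∧ r 0 = 0 ∧
        ∀ i, (tree (zdGraph d) (U ∘ Sym2.map (Site.shift x)) 0).Adj (r i) (r (i + 1)) := by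
  let φ : zdGraph d ≃g zdGraph d := { toEquiv := Site.shift x, map_rel_iff' := fun {a b} => zdGraph_adj_shift_iff x a b }
  have hφ0 : φ 0 = x := by show Site.shift x 0 = x; rw [Site.shift_apply, zero_add]
  have hUU' : ∀ u v, U s(φ u, φ v) = (U ∘ Sym2.map (Site.shift x)) s(u, v) := fun u v => by
    simp only [Function.comp_apply, Sym2.map_mk]; rfl
  have hinj : Set.InjOn (U ∘ Sym2.map (Site.shift x)) (zdGraph d).edgeSet :=
    (hU.comp (Sym2.map.injective (Site.shift x).injective)).injOn
  have e := existsUnique_ray_iff_of_iso φ hUU' hinj 0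
  rw [hφ0] at e
  exact e

/-- Same transport for "outlets beyond every time". [cite: LyonsPeresSchramm2006, Thm. 3.12 (proof)] -/
theorem forall_exists_isOutlet_root_iff (x : Site d) {U : Sym2 (Site d) → ℝ} (hU : Function.Injective U) :
    (∀ k, ∃ m, k ≤ m ∧ IsOutlet (zdGraph d) U x m) ↔ ∀ k, ∃ m, k ≤ m ∧ IsOutlet (zdGraph d) (U ∘ Sym2.map (Site.shift x)) 0 m := by
  let φ : zdGraph d ≃g zdGraph d := { toEquiv := Site.shift x, map_rel_iff' := fun {a b} => zdGraph_adj_shift_iff x a b }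
  have hφ0 : φ 0 = x := by show Site.shift x 0 = x; rw [Site.shift_apply, zero_add]
  have hUU' : ∀ u v, U s(φ u, φ v) = (U ∘ Sym2.map (Site.shift x)) s(u, v) := fun u v => by
    simp only [Function.comp_apply, Sym2.map_mk]; rfl
  have hinj : Set.InjOn (U ∘ Sym2.map (Site.shift x)) (zdGraph d).edgeSet :=
    (hU.comp (Sym2.map.injective (Site.shift x).injective)).injOn
  have e : ∀ m, IsOutlet (zdGraph d) U (φ 0) m ↔ IsOutlet (zdGraph d) (U ∘ Sym2.map (Site.shift x)) 0 m :=
    fun m => isOutlet_iso_iff φ hUU' hinj 0 m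
  rw [hφ0] at e
  simp only [e]

/-! ## §3 Almost surely every invasion tree of `ℤ^d` has exactly one ray from its root -/

/-- The pull-back of the label measure along a translation is the label measure (`labelMeasure_map_comp`); so a property holding for a.e. label field holds
a.e. for the pulled-back field. [folklore] -/
theorem ae_comp_shift {P : (Sym2 (Site d) → ℝ) → Prop} (h : ∀ᵐ U ∂(labelMeasure (Site d)), P U) (x : Site d) :
    ∀ᵐ U ∂(labelMeasure (Site d)), P (U ∘ Sym2.map (Site.shift x)) := by
  have hg : Function.Injective (Sym2.map (Site.shift x)) := Sym2.map.injective (Site.shift x).injective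
  have hmap := Literature.Barriers.CriticalPhenomena.labelMeasure_map_comp (V := Site d) hg
  have h' : ∀ᵐ U ∂((labelMeasure (Site d)).map fun U : Sym2 (Site d) → ℝ => U ∘ Sym2.map (Site.shift x)), P U := by rwa [hmap]
  exact ae_of_ae_map (Literature.Barriers.CriticalPhenomena.measurable_comp_labels _).aemeasurable h'

/-- **A.S., FOR EVERY ROOT `x ∈ ℤ^d` SIMULTANEOUSLY, THE INVASION TREE `T(x)` HAS OUTLETS BEYOND EVERY TIME AND EXACTLY ONE SELF-AVOIDING RAY FROM `x`**
(`d ≥ 2`, p205010; Lyons–Peres–Schramm 2006 Thm 3.12 ¶1 for every vertex of `ℤ^d`).  With file XXXIV (`𝔉_w = ⋃_x T(x)` a.s.): the WMSF of `ℤ^d` is a.s. a union of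
one-ended trees. [cite: LyonsPeresSchramm2006, Thm. 1.1 / Thm. 3.12 (proof, first paragraph)] -/
theorem ae_forall_root_existsUnique_ray (hd : 2 ≤ d) :
    ∀ᵐ U ∂(labelMeasure (Site d)), ∀ x : Site d,
      (∀ k, ∃ m, k ≤ m ∧ IsOutlet (zdGraph d) U x m) ∧
      ∃! r : ℕ → Site d, Function.Injective r ∧ r 0 = x ∧ ∀ i, (tree (zdGraph d) U x).Adj (r i) (r (i + 1)) := by
  haveI : Nonempty (Fin d) := ⟨⟨0, by omega⟩⟩
  haveI : Infinite (Site d) := Pi.infinite_of_right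
  have hall : ∀ x : Site d, ∀ᵐ U ∂(labelMeasure (Site d)),
      (∀ k, ∃ m, k ≤ m ∧ IsOutlet (zdGraph d) U x m) ∧
      ∃! r : ℕ → Site d, Function.Injective r ∧ r 0 = x ∧ ∀ i, (tree (zdGraph d) U x).Adj (r i) (r (i + 1)) := by
    intro x
    filter_upwards [Literature.Barriers.CriticalPhenomena.ae_injective_labelMeasure (V := Site d),
      ae_comp_shift (ae_forall_exists_isOutlet hd) x, ae_comp_shift (ae_existsUnique_ray hd) x] with U hU hout hray
    refine ⟨(forall_exists_isOutlet_root_iff x hU).2 fun k => (hout k).imp fun m hm => ⟨hm.1, hm.2.1⟩, ?_⟩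
    exact (existsUnique_ray_root_iff x hU).2 hray
  exact ae_all_iff.2 hall

/-- `ℤ³`: a.s. every invasion tree `T(x)`, `x ∈ ℤ³`, has exactly one ray from its root. [cite: LyonsPeresSchramm2006, Thm. 1.1 / Thm. 3.12] -/
theorem ae_forall_root_existsUnique_ray_Z3 :
    ∀ᵐ U ∂(labelMeasure (Site 3)), ∀ x : Site 3,
      ∃! r : ℕ → Site 3, Function.Injective r ∧ r 0 = x ∧ ∀ i, (tree (zdGraph 3) U x).Adj (r i) (r (i + 1)) := by
  filter_upwards [ae_forall_root_existsUnique_ray (d := 3) (by norm_num)] with U hU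
  exact fun x => (hU x).2

/-- **THE WMSF OF `ℤ^d` IS A.S. A UNION OF ONE-ENDED TREES** (`d ≥ 2`, p205010): almost surely `𝔉_w(U) = ⋃_x T_U(x)` (LPS06 Prop. 3.3, file XXXIV; labels a.s.
injective) and every `T_U(x)` has exactly one self-avoiding ray from `x`.  (LPS06 Thm 3.12's full conclusion — every COMPONENT of `𝔉_w` one-ended — additionally needs
their Prop. 3.4 and a mass-transport step; not claimed.) [cite: LyonsPeresSchramm2006, Prop. 3.3 and Thm. 3.12 (proof, first paragraph)] -/
theorem ae_wmsf_eq_iUnion_oneEnded_trees (hd : 2 ≤ d) :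
    ∀ᵐ U ∂(labelMeasure (Site d)), (⋃ x, treeEdges (zdGraph d) U x) = wmsf (zdGraph d) U ∧
      ∀ x : Site d, ∃! r : ℕ → Site d, Function.Injective r ∧ r 0 = x ∧ ∀ i, (tree (zdGraph d) U x).Adj (r i) (r (i + 1)) := by
  filter_upwards [ae_iUnion_treeEdges_eq_wmsf (d := d) (by omega), ae_forall_root_existsUnique_ray hd] with U h1 h2
  exact ⟨h1, fun x => (h2 x).2⟩

end Summit.CriticalPhenomena.PercolationContinuityZ3.Theorems.Rsw3
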